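import Mathlib
import HarnessLib
import Summits.ResolutionOfSingularities.ResolutionOfSingularities.Theorems.RadicialJungCleanModelsLens5UnimodularRefinement

/-!
# Positive unimodular refinement around an irrational ray (lens 5, part 2)

Port of `Cruxes/DescentPerfectToAll/Lens5_UnimodularRefinement.lean` (author: res-B-lens-5 g9/g10).
Part 2: Lexicographic variant, rank-3 lattice theorems, archimedean variant, and Smith-normal-form step.

OURS · counted 0.  Nothing here proves resolution in characteristic `p`; no crux or stub is proved here.
Pure lattice combinatorics, Mathlib-only, def-free.

## Main results

- `exists_unimodular_lex_refinement`: Unimodular refinement for lexicographic weights (class (C)).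
- `exists_adapted_basis_rank3`: TORIC LEMMA, class (B), `ρ = 2`, lattice form.
- `exists_adapted_basis_rank3_archimedean`: TORIC LEMMA, class (B), `ρ = 2`, archimedean values.
- `exists_kernel_adapted_basis`: Smith-normal-form step for kernel-adapted basis.

Resolution of singularities in positive characteristic is NOT proved.
-/

noncomputable section

set_option linter.dupNamespace false

namespace Summit.ResolutionOfSingularities.ResolutionOfSingularities.Theorems.RadicialJung.CleanModels.Lens5.UnimodularRefinement

/-! ## The lexicographic variant (CLASS (C): composite rank two) — a RATIONAL first weight: primitive vector + Bezout + shear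

For a composite rank-two valuation the value group has rational rank two, one per level, so the weight map on the plane `W* ∩ N′ ≅ ℤ²`
is `n ↦ (⟨n, w¹⟩, ⟨n, w²⟩)` LEXICOGRAPHICALLY with `w¹, w² ∈ ℤ²` independent (`w¹` = coarse weights, a RATIONAL ray).  The required cone is
then elementary: `n₁` := the primitive vector on the ray of `w¹`, `n₂` := a Bezout complement with `w²`-coordinate `b₂ > 0`, sheared along
`n₁` until every `f ∈ F` is non-negative on it.  Conclusion: `w¹ = g·n₁` (`g > 0`), `w² = b₁ n₁ + b₂ n₂` (`b₂ > 0`) — so the dual monomials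
have lex-values `(g, b₁) > 0` and `(0, b₂) > 0` — and `⟨f, n₁⟩, ⟨f, n₂⟩ ≥ 0` for every `f` of lex-positive value. -/

/-- **Unimodular refinement, lexicographic weights (class (C)).** -/
theorem exists_unimodular_lex_refinement (p₁ p₂ q₁ q₂ : ℤ) (hdet : p₁ * q₂ - p₂ * q₁ ≠ 0)
    (F : Finset (ℤ × ℤ))
    (hF : ∀ f ∈ F, 0 < f.1 * p₁ + f.2 * p₂ ∨ (f.1 * p₁ + f.2 * p₂ = 0 ∧ 0 < f.1 * q₁ + f.2 * q₂)) :
    ∃ (a b c d g b₁ b₂ : ℤ), (a * d - b * c = 1 ∨ a * d - b * c = -1) ∧ 0 < g ∧ 0 < b₂ ∧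
      p₁ = g * a ∧ p₂ = g * c ∧ q₁ = b₁ * a + b₂ * b ∧ q₂ = b₁ * c + b₂ * d ∧
      ∀ f ∈ F, 0 ≤ f.1 * a + f.2 * c ∧ 0 ≤ f.1 * b + f.2 * d := by
  -- the primitive vector `(a, c)` on the ray of `w¹ = (p₁, p₂)`
  have hp : p₁ ≠ 0 ∨ p₂ ≠ 0 := by
    by_contra h
    push Not at h
    obtain ⟨rfl, rfl⟩ := h
    exact hdet (by ring)
  have hg : 0 < Int.gcd p₁ p₂ := Int.gcd_pos_iff.mpr hp
  set g : ℤ := (Int.gcd p₁ p₂ : ℤ) with hgdef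
  have hg' : (0 : ℤ) < g := by rw [hgdef]; exact_mod_cast hg
  set a : ℤ := p₁ / g with hadef
  set c : ℤ := p₂ / g with hcdef
  have hpa : p₁ = g * a := (Int.mul_ediv_cancel' (Int.gcd_dvd_left p₁ p₂)).symm
  have hpc : p₂ = g * c := (Int.mul_ediv_cancel' (Int.gcd_dvd_right p₁ p₂)).symm
  have hac : Int.gcd a c = 1 := Int.gcd_div_gcd_div_gcd hg
  -- Bezout complement `(b₀, d₀)` with `a d₀ − b₀ c = 1`
  obtain ⟨x, y, hxy⟩ : ∃ x y : ℤ, a * x + c * y = 1 := by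
    refine ⟨Int.gcdA a c, Int.gcdB a c, ?_⟩
    have := Int.gcd_eq_gcd_ab a c
    rw [hac] at this
    exact_mod_cast this.symm
  set b₀ : ℤ := -y with hb₀
  set d₀ : ℤ := x with hd₀
  have hdet₀ : a * d₀ - b₀ * c = 1 := by rw [hb₀, hd₀]; linarith [hxy]
  -- coordinates of `w² = (q₁, q₂)` in the basis `(a,c), (b₀,d₀)`
  set β₁ : ℤ := q₁ * d₀ - q₂ * b₀ with hβ₁
  set β₂ : ℤ := a * q₂ - c * q₁ with hβ₂
  have hq₁ : q₁ = β₁ * a + β₂ * b₀ := by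
    have : q₁ * (a * d₀ - b₀ * c) = β₁ * a + β₂ * b₀ := by rw [hβ₁, hβ₂]; ring
    rw [hdet₀, mul_one] at this; exact this
  have hq₂ : q₂ = β₁ * c + β₂ * d₀ := by
    have : q₂ * (a * d₀ - b₀ * c) = β₁ * c + β₂ * d₀ := by rw [hβ₁, hβ₂]; ring
    rw [hdet₀, mul_one] at this; exact this
  have hβ₂0 : β₂ ≠ 0 := by
    intro h0
    apply hdet
    rw [hpa, hpc]
    have : g * a * q₂ - g * c * q₁ = g * β₂ := by rw [hβ₂]; ring
    rw [this, h0, mul_zero]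
  -- sign fix: `s = ±1` with `s β₂ > 0`
  obtain ⟨s, hs, hsβ⟩ : ∃ s : ℤ, (s = 1 ∨ s = -1) ∧ 0 < s * β₂ := by
    rcases lt_or_gt_of_ne hβ₂0 with h | h
    · exact ⟨-1, Or.inr rfl, by linarith⟩
    · exact ⟨1, Or.inl rfl, by linarith⟩
  have hss : s * s = 1 := by rcases hs with rfl | rfl <;> norm_num
  -- shear amount
  set t : ℤ := ∑ f ∈ F, |f.1 * (s * b₀) + f.2 * (s * d₀)| with ht
  have ht0 : ∀ f ∈ F, |f.1 * (s * b₀) + f.2 * (s * d₀)| ≤ t := fun f hf =>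
    Finset.single_le_sum (f := fun f : ℤ × ℤ => |f.1 * (s * b₀) + f.2 * (s * d₀)|) (fun _ _ => abs_nonneg _) hf
  -- the basis: n₁ = (a, c), n₂ = s (b₀, d₀) + t (a, c)
  refine ⟨a, s * b₀ + t * a, c, s * d₀ + t * c, g, β₁ - t * s * β₂, s * β₂, ?_, hg', hsβ, hpa, hpc, ?_, ?_, ?_⟩
  · have e : a * (s * d₀ + t * c) - (s * b₀ + t * a) * c = s * (a * d₀ - b₀ * c) := by ring
    rw [e, hdet₀, mul_one]; exact hs
  · rw [hq₁]
    have : β₂ * b₀ = s * s * β₂ * b₀ := by rw [hss, one_mul]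
    rw [this]; ring
  · rw [hq₂]
    have : β₂ * d₀ = s * s * β₂ * d₀ := by rw [hss, one_mul]
    rw [this]; ring
  · intro f hf
    have hfn₁ : g * (f.1 * a + f.2 * c) = f.1 * p₁ + f.2 * p₂ := by rw [hpa, hpc]; ring
    rcases hF f hf with hpos | ⟨hzero, hpos2⟩
    · -- `f(w¹) > 0`: `f(n₁) ≥ 1` and the shear dominates
      have h1 : 0 < f.1 * a + f.2 * c := by
        rw [← hfn₁] at hpos
        exact (pos_iff_pos_of_mul_pos hpos).mp hg'
      refine ⟨h1.le, ?_⟩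
      have e : f.1 * (s * b₀ + t * a) + f.2 * (s * d₀ + t * c) =
          (f.1 * (s * b₀) + f.2 * (s * d₀)) + t * (f.1 * a + f.2 * c) := by ring
      rw [e]
      have h2 := ht0 f hf
      have h3 : -(f.1 * (s * b₀) + f.2 * (s * d₀)) ≤ t := le_trans (neg_le_abs _) h2
      have h4 : t ≤ t * (f.1 * a + f.2 * c) := by
        have htnn : 0 ≤ t := le_trans (abs_nonneg _) h2
        nlinarith
      linarith
    · -- `f(w¹) = 0 < f(w²)`: `f(n₁) = 0` and `b₂ f(n₂) = f(w²) > 0`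
      have h1 : f.1 * a + f.2 * c = 0 := by
        rw [← hfn₁] at hzero
        rcases mul_eq_zero.mp hzero with h | h
        · exact absurd h hg'.ne'
        · exact h
      refine ⟨h1.symm.le, ?_⟩
      have e : f.1 * (s * b₀ + t * a) + f.2 * (s * d₀ + t * c) = s * (f.1 * b₀ + f.2 * d₀) + t * (f.1 * a + f.2 * c) := by ring
      rw [e, h1, mul_zero, add_zero]
      have hw2 : f.1 * q₁ + f.2 * q₂ = β₁ * (f.1 * a + f.2 * c) + β₂ * (f.1 * b₀ + f.2 * d₀) := by rw [hq₁, hq₂]; ring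
      rw [hw2, h1, mul_zero, zero_add] at hpos2
      -- `0 < β₂ * X` and `0 < s β₂` ⇒ `0 < s * X`... via `(s β₂) (s X) = β₂ X (s² = 1)`
      have : 0 < (s * β₂) * (s * (f.1 * b₀ + f.2 * d₀)) := by
        have e2 : (s * β₂) * (s * (f.1 * b₀ + f.2 * d₀)) = (s * s) * (β₂ * (f.1 * b₀ + f.2 * d₀)) := by ring
        rw [e2, hss, one_mul]; exact hpos2
      exact le_of_lt ((pos_iff_pos_of_mul_pos this).mp hsβ)

/-! ## (rev 4) The toric lemma in a rank-3 lattice, class (B), `ρ = 2` — change of basis adapted to the kernel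

Given a `ℤ`-basis `(e₀, e₁, e₂)` of a lattice `L` ADAPTED TO THE KERNEL of the (real) weight `φ` — `φ(e₂) = 0`, `φ(e₀), φ(e₁)` rationally
independent (this adapted basis is the Smith-normal-form bookkeeping left to the port: `ker φ` is saturated of rank one) — and a finite
`F ⊂ L` of positive weight, there is a new basis `(m₁, m₂, e₂)` (unimodular change in the `(e₀, e₁)`-plane) with `φ(m₁), φ(m₂) > 0` and every
`f ∈ F` having POSITIVE `m₁`- and `m₂`-coordinates: the dual monomials `u₁, u₂` have positive value, `u₃` value zero, and every piece
`g_{j,ab}` is a monomial in `u₁, u₂, u₃^{±1}` — memo §3 (i)–(iv) in primal form ((iii) is then automatic from (ii)). -/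

/-- **TORIC LEMMA, class (B), `ρ = 2`, lattice form.** -/
theorem exists_adapted_basis_rank3 {L : Type} [AddCommGroup L] (e : Module.Basis (Fin 3) ℤ L) (φ : L →+ ℝ)
    (hker : φ (e 2) = 0) (hind : ∀ u v : ℤ, (u : ℝ) * φ (e 0) + v * φ (e 1) = 0 → u = 0 ∧ v = 0)
    (F : Finset L) (hF : ∀ f ∈ F, 0 < φ f) :
    ∃ (m₁ m₂ : L) (a b c d : ℤ), (a * d - b * c = 1 ∨ a * d - b * c = -1) ∧
      e 0 = a • m₁ + b • m₂ ∧ e 1 = c • m₁ + d • m₂ ∧ 0 < φ m₁ ∧ 0 < φ m₂ ∧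
      ∀ f ∈ F, f = (e.repr f 0 * a + e.repr f 1 * c) • m₁ + (e.repr f 0 * b + e.repr f 1 * d) • m₂ + e.repr f 2 • e 2 ∧
        0 < e.repr f 0 * a + e.repr f 1 * c ∧ 0 < e.repr f 0 * b + e.repr f 1 * d := by
  classical
  -- every `f` in coordinates
  have hrepr : ∀ f : L, f = e.repr f 0 • e 0 + e.repr f 1 • e 1 + e.repr f 2 • e 2 := by
    intro f
    conv_lhs => rw [← e.sum_repr f]
    rw [Fin.sum_univ_three]
  have hφ : ∀ f : L, φ f = (e.repr f 0 : ℝ) * φ (e 0) + (e.repr f 1 : ℝ) * φ (e 1) := by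
    intro f
    conv_lhs => rw [hrepr f]
    rw [map_add, map_add, map_zsmul, map_zsmul, map_zsmul, hker, smul_zero, add_zero, zsmul_eq_mul, zsmul_eq_mul]
  -- the plane problem
  obtain ⟨a, b, c, d, α, β, hα, hβ, hdet, h0, h1, hpos⟩ :=
    exists_unimodular_positive_refinement' (φ (e 0)) (φ (e 1)) hind (F.image fun f => (e.repr f 0, e.repr f 1))
      (by
        intro g hg
        obtain ⟨f, hf, rfl⟩ := Finset.mem_image.mp hg
        simpa [hφ f] using hF f hf)
  -- the new basis vectors (inverse of the unimodular matrix, sign-corrected)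
  obtain ⟨ε, hε, hεdet⟩ : ∃ ε : ℤ, (ε = 1 ∨ ε = -1) ∧ ε * (a * d - b * c) = 1 := by
    rcases hdet with h | h
    · exact ⟨1, Or.inl rfl, by rw [h]; ring⟩
    · exact ⟨-1, Or.inr rfl, by rw [h]; ring⟩
  refine ⟨ε • (d • e 0 - b • e 1), ε • (-c • e 0 + a • e 1), a, b, c, d, hdet, ?_, ?_, ?_, ?_, ?_⟩
  · -- `e 0 = a m₁ + b m₂`
    have : a • (ε • (d • e 0 - b • e 1)) + b • (ε • (-c • e 0 + a • e 1)) = (ε * (a * d - b * c)) • e 0 := by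
      module
    rw [this, hεdet, one_smul]
  · have : c • (ε • (d • e 0 - b • e 1)) + d • (ε • (-c • e 0 + a • e 1)) = (ε * (a * d - b * c)) • e 1 := by
      module
    rw [this, hεdet, one_smul]
  · -- `φ m₁ = α`
    have : φ (ε • (d • e 0 - b • e 1)) = (ε * (a * d - b * c) : ℤ) * α := by
      rw [map_zsmul, map_sub, map_zsmul, map_zsmul, h0, h1]
      simp only [zsmul_eq_mul, Int.cast_mul, Int.cast_sub]
      ring
    rw [this, hεdet]; simpa using hα
  · have : φ (ε • (-c • e 0 + a • e 1)) = (ε * (a * d - b * c) : ℤ) * β := by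
      rw [map_zsmul, map_add, map_zsmul, map_zsmul, h0, h1]
      simp only [zsmul_eq_mul, Int.cast_mul, Int.cast_sub, Int.cast_neg]
      ring
    rw [this, hεdet]; simpa using hβ
  · intro f hf
    have hg := hpos (e.repr f 0, e.repr f 1) (Finset.mem_image.mpr ⟨f, hf, rfl⟩)
    refine ⟨?_, hg.1, hg.2⟩
    have key : (e.repr f 0 * a + e.repr f 1 * c) • (ε • (d • e 0 - b • e 1)) +
        (e.repr f 0 * b + e.repr f 1 * d) • (ε • (-c • e 0 + a • e 1)) =
        (ε * (a * d - b * c) * e.repr f 0) • e 0 + (ε * (a * d - b * c) * e.repr f 1) • e 1 := by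
      module
    rw [key, hεdet, one_mul, one_mul]
    exact hrepr f

/-! ## (rev 5) Class (B) with values in any ARCHIMEDEAN ordered group (the port's value group, no `ℝ` needed upstream)

Class (B) means the valuation has rank one, i.e. its value group is archimedean (`Valuation.nonempty_rankOne_iff_mulArchimedean`); the
weight `φ` of §3 then takes values in an archimedean linearly ordered additive group `W` (e.g. `Additive Γˣ`), which embeds into `ℝ` by an
injective ordered homomorphism (Hölder; Mathlib `Archimedean.exists_orderAddMonoidHom_real_injective`).  So the lattice toric lemma holds
verbatim with `φ : L →+ W`. -/

/-- **TORIC LEMMA, class (B), `ρ = 2`, lattice form, archimedean values.** -/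
theorem exists_adapted_basis_rank3_archimedean {L : Type} [AddCommGroup L] {W : Type} [AddCommGroup W] [LinearOrder W]
    [IsOrderedAddMonoid W] [Archimedean W] (e : Module.Basis (Fin 3) ℤ L) (φ : L →+ W)
    (hker : φ (e 2) = 0) (hind : ∀ u v : ℤ, u • φ (e 0) + v • φ (e 1) = 0 → u = 0 ∧ v = 0)
    (F : Finset L) (hF : ∀ f ∈ F, 0 < φ f) :
    ∃ (m₁ m₂ : L) (a b c d : ℤ), (a * d - b * c = 1 ∨ a * d - b * c = -1) ∧
      e 0 = a • m₁ + b • m₂ ∧ e 1 = c • m₁ + d • m₂ ∧ 0 < φ m₁ ∧ 0 < φ m₂ ∧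
      ∀ f ∈ F, f = (e.repr f 0 * a + e.repr f 1 * c) • m₁ + (e.repr f 0 * b + e.repr f 1 * d) • m₂ + e.repr f 2 • e 2 ∧
        0 < e.repr f 0 * a + e.repr f 1 * c ∧ 0 < e.repr f 0 * b + e.repr f 1 * d := by
  obtain ⟨ι, hι⟩ := Archimedean.exists_orderAddMonoidHom_real_injective W
  have hι0 : ∀ w : W, ι w = 0 ↔ w = 0 := fun w => by
    constructor
    · intro h; exact hι (by rw [h, map_zero])
    · intro h; rw [h, map_zero]
  have hιpos : ∀ w : W, 0 < ι w ↔ 0 < w := fun w => by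
    constructor
    · intro h
      by_contra hle
      have hmono : ι w ≤ ι 0 := OrderHomClass.mono ι (not_lt.mp hle)
      rw [map_zero] at hmono
      exact absurd h (not_lt.mpr hmono)
    · intro h
      have hmono : ι 0 ≤ ι w := OrderHomClass.mono ι h.le
      rw [map_zero] at hmono
      rcases hmono.lt_or_eq with hlt | heq
      · exact hlt
      · exact absurd ((hι0 w).mp heq.symm) h.ne'
  let ψ : L →+ ℝ := (ι : W →+ ℝ).comp φ
  have hψ : ∀ x : L, ψ x = ι (φ x) := fun x => rfl
  have hkerψ : ψ (e 2) = 0 := by rw [hψ, hker, map_zero]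
  have hindψ : ∀ u v : ℤ, (u : ℝ) * ψ (e 0) + v * ψ (e 1) = 0 → u = 0 ∧ v = 0 := by
    intro u v huv
    apply hind u v
    rw [← hι0]
    rw [map_add, map_zsmul, map_zsmul, zsmul_eq_mul, zsmul_eq_mul]
    simpa [hψ] using huv
  have hFψ : ∀ f ∈ F, 0 < ψ f := fun f hf => by rw [hψ, hιpos]; exact hF f hf
  obtain ⟨m₁, m₂, a, b, c, d, hdet, h0, h1, hm₁, hm₂, hcoord⟩ := exists_adapted_basis_rank3 e ψ hkerψ hindψ F hFψ
  refine ⟨m₁, m₂, a, b, c, d, hdet, h0, h1, ?_, ?_, hcoord⟩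
  · rw [hψ, hιpos] at hm₁; exact hm₁
  · rw [hψ, hιpos] at hm₂; exact hm₂

/-! ## (rev 6) The Smith-normal-form step: a basis ADAPTED TO THE KERNEL exists (class (B), `ρ = 2`)

For a rank-3 lattice `L` and an additive `φ : L → W` (`W` torsion-free, e.g. any linearly ordered additive group) whose kernel has rank exactly one
— some non-zero `x` with `φ x = 0`, and any two kernel elements dependent — there is a `ℤ`-basis `(e₀, e₁, e₂)` of `L` with `φ(e₂) = 0` and
`φ(e₀), φ(e₁)` independent; this is the input of `exists_adapted_basis_rank3(_archimedean)`.  Proof: Smith normal form of `ker φ ≤ L`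
(Mathlib `Submodule.smithNormalForm`): `bN i = a_i • bM (f i)`, `a_i ≠ 0`, hence `bM (f i) ∈ ker φ` (`W` torsion-free — the kernel is
saturated); exactly one `i` (two would be independent kernel vectors, none would make the kernel zero); re-index so that it sits at `2`. -/

/-- Smith-normal-form step: from a kernel of rank one, extract a basis with one kernel vector. -/
theorem exists_kernel_adapted_basis {L : Type} [AddCommGroup L] (b : Module.Basis (Fin 3) ℤ L) {W : Type} [AddCommGroup W]
    [NoZeroSMulDivisors ℤ W] (φ : L →+ W) (h1 : ∃ x : L, x ≠ 0 ∧ φ x = 0)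
    (h2 : ∀ x y : L, φ x = 0 → φ y = 0 → ∃ s t : ℤ, (s ≠ 0 ∨ t ≠ 0) ∧ s • x + t • y = 0) :
    ∃ e : Module.Basis (Fin 3) ℤ L, φ (e 2) = 0 ∧ ∀ u v : ℤ, u • φ (e 0) + v • φ (e 1) = 0 → u = 0 ∧ v = 0 := by
  classical
  let N : Submodule ℤ L := LinearMap.ker φ.toIntLinearMap
  have hN : ∀ x : L, x ∈ N ↔ φ x = 0 := fun x => by
    simp only [N, LinearMap.mem_ker, AddMonoidHom.coe_toIntLinearMap]
  obtain ⟨n, snf⟩ := Submodule.smithNormalForm b N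
  -- the kernel is saturated: each `bM (f i)` lies in it
  have hfi : ∀ i : Fin n, φ (snf.bM (snf.f i)) = 0 := by
    intro i
    have hmem : ((snf.bN i : N) : L) ∈ N := (snf.bN i).2
    rw [hN, snf.snf i, map_zsmul] at hmem
    have hai : snf.a i ≠ 0 := by
      intro h0
      have h0' : ((snf.bN i : N) : L) = 0 := by rw [snf.snf i, h0, zero_smul]
      exact snf.bN.ne_zero i (Subtype.ext h0')
    exact (smul_eq_zero.mp hmem).resolve_left hai
  -- two distinct `f i`, `f j` would be independent kernel vectors
  have hn2 : ∀ i j : Fin n, i = j := by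
    intro i j
    by_contra hij
    obtain ⟨s, t, hst, hrel⟩ := h2 _ _ (hfi i) (hfi j)
    have hfij : snf.f i ≠ snf.f j := fun h => hij (snf.f.injective h)
    have hci := congrArg (fun x => snf.bM.repr x (snf.f i)) hrel
    have hcj := congrArg (fun x => snf.bM.repr x (snf.f j)) hrel
    simp only [map_add, map_zsmul, Module.Basis.repr_self, Finsupp.coe_add, Finsupp.coe_smul, Pi.add_apply,
      Pi.smul_apply, Finsupp.single_apply, map_zero, Finsupp.coe_zero, Pi.zero_apply] at hci hcj
    simp [hfij, hfij.symm] at hci hcj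
    rcases hst with hs | ht
    · exact hs hci
    · exact ht hcj
  -- and `n = 0` would make the kernel trivial
  have hn0 : n ≠ 0 := by
    intro hn
    subst hn
    obtain ⟨x, hx0, hx⟩ := h1
    have hxN : x ∈ N := (hN x).mpr hx
    have hsum := snf.bN.sum_repr ⟨x, hxN⟩
    rw [Finset.univ_eq_empty, Finset.sum_empty] at hsum
    exact hx0 (by simpa using congrArg Subtype.val hsum.symm)
  -- so `n = 1`
  obtain ⟨i₀⟩ : Nonempty (Fin n) := Fin.pos_iff_nonempty.mp (Nat.pos_of_ne_zero hn0)
  -- re-index: the kernel vector goes to position `2`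
  let σ : Fin 3 ≃ Fin 3 := Equiv.swap (snf.f i₀) 2
  refine ⟨snf.bM.reindex σ, ?_, ?_⟩
  · rw [Module.Basis.reindex_apply]
    have : σ.symm 2 = snf.f i₀ := by
      rw [Equiv.symm_apply_eq]
      exact (Equiv.swap_apply_left _ _).symm
    rw [this]
    exact hfi i₀
  · intro u v huv
    -- `y := u e₀ + v e₁ ∈ ker φ = ℤ bN i₀ = ℤ a • bM (f i₀)`
    have hy : φ (u • snf.bM.reindex σ 0 + v • snf.bM.reindex σ 1) = 0 := by
      rw [map_add, map_zsmul, map_zsmul, huv]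
    have hyN : u • snf.bM.reindex σ 0 + v • snf.bM.reindex σ 1 ∈ N := (hN _).mpr hy
    have hsum := snf.bN.sum_repr ⟨_, hyN⟩
    have huniv : (Finset.univ : Finset (Fin n)) = {i₀} := by
      ext j; simp [hn2 j i₀]
    rw [huniv, Finset.sum_singleton] at hsum
    have hval := congrArg Subtype.val hsum
    simp only [Submodule.coe_smul_of_tower] at hval
    rw [snf.snf i₀] at hval
    -- compare coordinates at `0` and `1` in the basis `bM.reindex σ`
    have hσ0 : σ.symm 0 ≠ snf.f i₀ := by
      rw [Ne, Equiv.symm_apply_eq]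
      intro h
      have := Equiv.swap_apply_left (snf.f i₀) (2 : Fin 3)
      rw [this] at h
      exact absurd h (by decide)
    have hσ1 : σ.symm 1 ≠ snf.f i₀ := by
      rw [Ne, Equiv.symm_apply_eq]
      intro h
      have := Equiv.swap_apply_left (snf.f i₀) (2 : Fin 3)
      rw [this] at h
      exact absurd h (by decide)
    have hc0 := congrArg (fun x => (snf.bM.reindex σ).repr x 0) hval
    have hc1 := congrArg (fun x => (snf.bM.reindex σ).repr x 1) hval
    simp only [map_add, map_zsmul, Module.Basis.repr_self, Finsupp.coe_add, Finsupp.coe_smul, Pi.add_apply,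
      Pi.smul_apply, Finsupp.single_apply, Module.Basis.repr_reindex_apply, smul_eq_mul] at hc0 hc1
    simp [Ne.symm hσ0, Ne.symm hσ1] at hc0 hc1
    exact ⟨hc0.symm, hc1.symm⟩

end Summit.ResolutionOfSingularities.ResolutionOfSingularities.Theorems.RadicialJung.CleanModels.Lens5.UnimodularRefinement

end
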